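import Summits.HubbardSuperconductivity.HubbardSuperconductivity.Theorems.NodalWardXYDefs

/-!
# `PerturbedXYOrder` — the bond-diagonal ("generalised Fisher zero") special case it contains

Crux stmt-HubbardSuperconductivity-10739, line `schwarz-inheritance`, continuation lead c4 (delineation).

Taking the kernel `K = z·δ_{bb'}` (`‖z‖ ≤ ε`), which is admissible at radius `ε`, the perturbed weight
factorises over bonds, `w_J e^{W_K} = Π_b exp(J cos ∇_bθ + z sin² ∇_bθ)`: a translation-invariant
nearest-neighbour plane rotator with a COMPLEX single-bond weight.  The crux therefore contains the statement
that this one-parameter complex deformation of the low-temperature rotator has a zero-free partition function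
(and positive plateau) UNIFORMLY IN THE VOLUME — "no Fisher-type zeros of an energy-like parameter pinch the real
axis inside the ordered phase", i.e. uniform analyticity of `L⁻³ log Z_L` in a thermal-like complex parameter at
fixed large `J`, which Bricmont–Fontaine–Lebowitz–Lieb–Spencer (CMP 78 (1981) 545–566, p. 546) explicitly do not
reach (their low-temperature expansion is asymptotic) and which is not in print since.  Recorded so that planners
can see, in Lean, the classical open problem every re-lining of this crux must in particular solve.
-/

noncomputable section

namespace Summit.HubbardSuperconductivity.HubbardSuperconductivity.Theorems.PerturbedXYOrder

open MeasureTheory Literature.Probability.LatticeModels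
open Summit.HubbardSuperconductivity.HubbardSuperconductivity.Theses.NodalWardXY

variable {L : ℕ}

/-- The bond-diagonal kernel `z·δ_{bb'}` is admissible at radius `ε` as soon as `‖z‖ ≤ ε`. -/
theorem bd_admissible_diagonal [NeZero L] {ε : ℝ} {z : ℂ} (hz : ‖z‖ ≤ ε) :
    Admissible L ε (fun b b' : Bond L => if b = b' then z else 0) := by
  have hε : 0 ≤ ε := (norm_nonneg z).trans hz
  intro b b'
  by_cases h : b = b'
  · subst h
    simp only [if_true, SimpleGraph.dist_self, Nat.cast_zero, add_zero, one_pow, div_one]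
    exact hz
  · simp only [if_neg h, norm_zero]
    positivity

/-- **The crux contains the bond-diagonal special case.** `PerturbedXYOrder` implies: for some `J₀`,
`ε > 0`, `a > 0`, for all `J ≥ J₀`, all `L ≥ 2` and all `z ∈ ℂ` with `‖z‖ ≤ ε`, the nearest-neighbour
rotator with complex single-bond weight `exp(J cos x + z sin² x)` on `(ℤ/Lℤ)³` has `Z ≠ 0` and plateau `≥ a`. -/
theorem perturbedXYOrder_bondDiagonal : PerturbedXYOrder → ∃ J₀ ε a : ℝ, 0 < ε ∧ 0 < a ∧ ∀ J : ℝ, J₀ ≤ J →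
    ∀ (L : ℕ) [NeZero L], 2 ≤ L → ∀ z : ℂ, ‖z‖ ≤ ε → Zk J (fun b b' : Bond L => if b = b' then z else 0) ≠ 0 ∧
      a ≤ (cratio L J (fun b b' : Bond L => if b = b' then z else 0)).re := by
  intro h
  obtain ⟨J₀, ε, a, hε, ha, hall⟩ := perturbedXYOrder_iff.1 h
  exact ⟨J₀, ε, a, hε, ha, fun J hJ L _ hL z hz => hall J hJ L hL _ (bd_admissible_diagonal hz)⟩

end Summit.HubbardSuperconductivity.HubbardSuperconductivity.Theorems.PerturbedXYOrder

end
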